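import Mathlib
import HarnessLib.Audit
import Summits.PneNP.PneNP.Theorems.PstarGateCasePNorHolders
import Summits.PneNP.PneNP.Theorems.PstarBridgeJoins
import Summits.PneNP.PneNP.Theorems.PstarNorCoreTools
import Summits.PneNP.PneNP.Theorems.PstarNorUnitBridge
import Summits.PneNP.PneNP.Theorems.PstarChordBridgeFundamental

/-!
# One GATED chord, node N1 (CASE P, all other chords (NOR)): the boundary count on the gated CYCLE (E2; prover-1 g18)

FRONTIER range-avoidance ladder, rung F-N3 (`stmt-PneNP-19007`), cell `pnp-ideate` (`PstarGateNodesX.GateCasePNorX`; this seat's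
`HOME/pnp-ideate-prover-1/g18/E2-PLAN-v3.md` §3); restricted-model proof complexity — nothing here bears on `P` versus `NP`.

`(r, 3/2)`-boundary accounting with the holders of `PstarGateCasePNorHolders.nor_holders`: a tree edge has at most ONE boundary variable (XOR slots
inner, one AND slot held twice), the gated chord one (`p ∈ g₀`), every other chord two, `g₀` and a gate realiser `g` two each.
* `caseP_nor_count` — on `X = J₀ ∪ {g₀, g}`: **`#(J₀ ∖ N) ≤ #(N − e) + [g ∉ J₀]`**;
* `caseP_nor_count_cycle` — on `X₂ = (D e + e) ∪ {g₀, g}` (if the tree were `D e` alone): **`J₀ ∖ N ≠ D e`**.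
With `PstarGateCasePNor.caseP_nor_units` (`#(N − e) ≤ 2`) the two counts leave of node N1 only `#(N − e) = 2`, `#(J₀ ∖ N) = 3 > #D e = 2`, which the
CONS-T literal structure excludes (`PstarGateFibreRank.avoid_nonempty`: the two edges of `D e` would both hold the same literal) — the assembly is the
successor's `gateCasePNorX_holds`.
-/

set_option linter.dupNamespace false -- `Summit.PneNP.PneNP.…`: summit = sub-problem name (D-0017 single-conjunct layout)

open Finset Module Literature.Computability.Complexity
open Summit.PneNP.PneNP.Theorems.PstarTyped (Typed)
open Summit.PneNP.PneNP.Theorems.PstarSALevel (varSet bdry BoundaryExpanding SimpleOverlap)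
open Summit.PneNP.PneNP.Theorems.PstarGapLinearised (andPair andPair_subset_varSet)
open Summit.PneNP.PneNP.Theorems.PstarGapPeeling (not_mem_varSet_of_private)
open Summit.PneNP.PneNP.Theorems.PstarChordEndgameTools (mem_andPair_iff)
open Summit.PneNP.PneNP.Theorems.PstarCentreFree (vars_mem_varSet)
open Summit.PneNP.PneNP.Theorems.PstarXCore (xverts)
open Summit.PneNP.PneNP.Theorems.PstarCoreBound (XorClosed)
open Summit.PneNP.PneNP.Theorems.PstarReadSumset (V2)
open Summit.PneNP.PneNP.Theorems.PstarChordSystem (ChordSystem)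
open Summit.PneNP.PneNP.Theorems.PstarChordBridgeTools (privs coef)
open Summit.PneNP.PneNP.Theorems.PstarChordBridge (BridgeData sys Solution Lift)
open Summit.PneNP.PneNP.Theorems.PstarChordBridgeCotree (Peelable)
open Summit.PneNP.PneNP.Theorems.PstarChordBridgeForcing (gam freeMon)
open Summit.PneNP.PneNP.Theorems.PstarChordBridgeBasis (qDir polarDir)
open Summit.PneNP.PneNP.Theorems.PstarNorUnitDir (nor_unit_of_dir lit_iff_of_dir)
open Summit.PneNP.PneNP.Theorems.PstarNorCoreTools (not_mem_bdry_of_two card_varSet_inter_bdry_le card_bdry_le_sum)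
open Summit.PneNP.PneNP.Theorems.PstarNorUnitBridge (xor_not_mem_bdry_of_even)
open Summit.PneNP.PneNP.Theorems.PstarGateBridge (GateHyp)
open Summit.PneNP.PneNP.Theorems.PstarGateCasePRegimes (NorCert)
open Summit.PneNP.PneNP.Theorems.PstarGateNodes (GateData ReadAlong AllRead)
open Summit.PneNP.PneNP.Theorems.PstarGateNodesX (GateDataX)
open Summit.PneNP.PneNP.Theorems.PstarGateCasePNorJoins (caseP_nor_structure)
open Summit.PneNP.PneNP.Theorems.PstarBridgeJoins (mem_join_of_not_mem_fundamental)
open Summit.PneNP.PneNP.Theorems.PstarGateCasePNorHolders (not_mem_bdry_of_closed not_mem_bdry_sup card_three_slots nor_holders)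

namespace Summit.PneNP.PneNP.Theorems.PstarGateCasePNorCountCycle

variable {n m : ℕ}

/-- **N1 cycle count**: CASE P, all other chords (NOR) ⟹ the tree is NOT the gated path alone (on the cycle `D e + e` with `g₀`, `g` the
count would read `#D e ≤ [g gate]`). -/
theorem caseP_nor_count_cycle (I : LocalMap 4 n m) (hI : I.IsPure xorAndPred) (hT : Typed I) (hS : SimpleOverlap I) {r : ℕ}
    (hB : BoundaryExpanding r I) {B : BridgeData n m} {e g₀ : Fin m} {u : Fin n} {κ₀ : ZMod 2} (hD : GateDataX I r B e g₀ u κ₀)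
    (hRA : ReadAlong I B e (1, 0)) (hread : AllRead I B e) (hNOR : ∀ e' ∈ B.N, e' ≠ e → NorCert I B (B.D e') (gam B e'))
    (hne : (B.N.erase e).Nonempty) :
    ∃ g ∈ B.T₁ ∪ freeMon I B.N B.G₁ ∪ (B.T₂ ∪ freeMon I B.N B.G₂), B.J₀ \ B.N ≠ B.D e := by
  classical
  obtain ⟨hXc, hW, hr, hd₁, hd₂, hL, hPe, -, hG, hg₀, hgv, hju, -, -, -, hcoef, hT3, hM0⟩ := id hD
  have he : e ∈ B.N := hG.1
  have heJ : e ∈ B.J₀ := hW.hN he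
  have hg₀J : g₀ ∉ B.J₀ := fun h => disjoint_left.1 hd₁ hg₀ h
  obtain ⟨j₁, j₂, g, σ, τ, hj₁T, hj₂T, hne12, hστ, hσ, hτ, hg, hσg, hτg, hgg₀, hgR, hholder, hg₀slots, hgslots⟩ :=
    nor_holders I hI hT hS hB hD hRA hread hNOR hne
  refine ⟨g, hg, ?_⟩
  set T := B.J₀ \ B.N with hTdef
  have hTJ : T ⊆ B.J₀ := sdiff_subset
  set H : Finset (Fin m) := {j₁, j₂, g₀, g} with hHdef
  have hg₀H : g₀ ∈ H := by simp [hHdef]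
  have hj₁H : j₁ ∈ H := by simp [hHdef]
  have hj₂H : j₂ ∈ H := by simp [hHdef]
  set X : Finset (Fin m) := B.J₀ ∪ {g₀, g} with hXdef
  have hJX : B.J₀ ⊆ X := subset_union_left
  have hg₀X : g₀ ∈ X := mem_union_right _ (by simp)
  have hgX : g ∈ X := mem_union_right _ (by simp)
  have hHX : H ⊆ X := by
    intro k hk
    simp only [hHdef, mem_insert, mem_singleton] at hk
    rcases hk with rfl | rfl | rfl | rfl
    exacts [hJX (hTJ hj₁T), hJX (hTJ hj₂T), hg₀X, hgX]
  have hXR : X ⊆ B.J₀ ∪ B.G₁ ∪ B.G₂ := by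
    refine union_subset (subset_union_left.trans subset_union_left) ?_
    intro k hk
    rw [mem_insert, mem_singleton] at hk
    rcases hk with rfl | rfl
    · exact mem_union_left _ (mem_union_right _ hg₀)
    · exact hgR
  have hXr : X.card ≤ r := (card_le_card hXR).trans hr
  set Gx : Finset (Fin m) := ({g₀, g} : Finset (Fin m)) \ B.J₀ with hGx
  have hGcard : Gx.card = 1 + (if g ∈ B.J₀ then 0 else 1) := by
    rw [hGx]
    by_cases hgJ : g ∈ B.J₀
    · rw [if_pos hgJ]
      have : ({g₀, g} : Finset (Fin m)) \ B.J₀ = {g₀} := by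
        ext k
        simp only [mem_sdiff, mem_insert, mem_singleton]
        constructor
        · rintro ⟨h | h, hk⟩
          · exact h
          · exact absurd (h ▸ hgJ) hk
        · rintro rfl; exact ⟨Or.inl rfl, hg₀J⟩
      rw [this, card_singleton]
    · rw [if_neg hgJ]
      have : ({g₀, g} : Finset (Fin m)) \ B.J₀ = {g₀, g} := by
        ext k
        simp only [mem_sdiff, mem_insert, mem_singleton]
        constructor
        · rintro ⟨h, -⟩; exact h
        · rintro (rfl | rfl)
          · exact ⟨Or.inl rfl, hg₀J⟩
          · exact ⟨Or.inr rfl, hgJ⟩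
      rw [this, card_pair (Ne.symm hgg₀)]
  intro hTD
  ------------------------------------------------------------------ the same count on the cycle `D e + e` with `g₀`, `g`
  set C : Finset (Fin m) := insert e (B.D e) with hCdef
  set X₂ : Finset (Fin m) := C ∪ {g₀, g} with hX₂def
  have heD : e ∉ B.D e := fun h => (mem_sdiff.1 (hW.hD e he h)).2 he
  have hCJ : C ⊆ B.J₀ := insert_subset heJ (hTD ▸ hTJ)
  have hCX₂ : C ⊆ X₂ := subset_union_left
  have hTC : T ⊆ C := fun k hk => mem_insert_of_mem (hTD ▸ hk)
  have hHX₂ : H ⊆ X₂ := by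
    intro k hk
    simp only [hHdef, mem_insert, mem_singleton] at hk
    rcases hk with rfl | rfl | rfl | rfl
    · exact hCX₂ (hTC hj₁T)
    · exact hCX₂ (hTC hj₂T)
    · exact mem_union_right _ (by simp)
    · exact mem_union_right _ (by simp)
  have hX₂r : X₂.card ≤ r := (card_le_card ((union_subset_union hCJ (Subset.refl _)).trans hXR)).trans hr
  have hcyc := xor_not_mem_bdry_of_even I hI (hW.hDeven e he)
  let q₂ : Fin m → ℕ := fun k => if k ∈ C then 1 else 2
  have hq₂ : ∀ k ∈ X₂, (varSet I k ∩ bdry I X₂).card ≤ q₂ k := by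
    intro k hk
    by_cases hkC : k ∈ C
    · simp only [q₂, if_pos hkC]
      rcases mem_insert.1 hkC with rfl | hkD
      · -- the gated chord
        have hp_g₀ : I.vars k 2 ∈ varSet I g₀ := by
          rcases hgv with ⟨h2, -⟩ | ⟨-, h3⟩
          · exact h2 ▸ vars_mem_varSet I g₀ 2
          · exact h3 ▸ vars_mem_varSet I g₀ 3
        have h := card_varSet_inter_bdry_le I X₂ k {0, 1, 2} (fun s' hs' => by
          simp only [mem_insert, mem_singleton] at hs'
          rcases hs' with rfl | rfl | rfl
          · exact not_mem_bdry_sup I hCX₂ hkC (vars_mem_varSet I k 0) (hcyc k hkC 0 (by decide))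
          · exact not_mem_bdry_sup I hCX₂ hkC (vars_mem_varSet I k 1) (hcyc k hkC 1 (by decide))
          · exact not_mem_bdry_of_two I hk (hHX₂ hg₀H) (fun h => hg₀J (h ▸ heJ)) (vars_mem_varSet I k 2) hp_g₀)
        have h3 : ({0, 1, 2} : Finset (Fin 4)).card = 3 := by decide
        rw [h3] at h
        exact h
      · -- a tree edge
        have hkT : k ∈ T := hTD ▸ hkD
        obtain ⟨s, hs, k', hk'H, hne, hv⟩ := hholder k hkT
        have h := card_varSet_inter_bdry_le I X₂ k {0, 1, s} (fun s' hs' => by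
          simp only [mem_insert, mem_singleton] at hs'
          rcases hs' with rfl | rfl | rfl
          · exact not_mem_bdry_sup I hCX₂ hkC (vars_mem_varSet I k 0) (hcyc k hkC 0 (by decide))
          · exact not_mem_bdry_sup I hCX₂ hkC (vars_mem_varSet I k 1) (hcyc k hkC 1 (by decide))
          · exact not_mem_bdry_of_two I hk (hHX₂ hk'H) (Ne.symm hne) (vars_mem_varSet I k s') hv)
        rw [card_three_slots hs] at h
        exact h
    · simp only [q₂, if_neg hkC]
      have hkJ : k ∉ B.J₀ := by
        intro hkJ
        rcases mem_union.1 hk with h | h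
        · exact hkC h
        · simp only [mem_insert, mem_singleton] at h
          rcases h with rfl | rfl
          · exact hg₀J hkJ
          · -- `g ∈ J₀` would be a tree edge with pair `{σ, τ}`, i.e. in `C`
            rcases mem_union.1 hg with hg' | hg' <;> rcases mem_union.1 hg' with hg' | hg'
            · exact hkC (hTC (hW.hT₁ hg'))
            · exact disjoint_left.1 hd₁ (mem_filter.1 hg').1 hkJ
            · exact hkC (hTC (hW.hT₂ hg'))
            · exact disjoint_left.1 hd₂ (mem_filter.1 hg').1 hkJ
      have hk' : k = g₀ ∨ k = g := by
        rcases mem_union.1 hk with h | h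
        · exact absurd h hkC
        · simpa only [mem_insert, mem_singleton] using h
      have hAND : ∀ s' : Fin 4, 2 ≤ s'.val → ∃ k' ∈ X₂, k' ≠ k ∧ I.vars k s' ∈ varSet I k' := by
        intro s' hs'
        have hs23 : s' = 2 ∨ s' = 3 := by
          rcases s' with ⟨s', h4⟩
          simp only [Fin.ext_iff]
          simp only at hs'
          omega
        rcases hk' with rfl | rfl
        · obtain ⟨j₀, hj₀, hju'⟩ := hju
          have hj₀X : j₀ ∈ X₂ := hCX₂ (hTC hj₀)
          have hj₀ne : j₀ ≠ k := fun h => hkJ (h ▸ (mem_sdiff.1 hj₀).1)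
          have hu_j₀ : u ∈ varSet I j₀ := by rcases hju' with h | h <;> rw [h] <;> exact vars_mem_varSet I j₀ _
          have hp_e : I.vars e 2 ∈ varSet I e := vars_mem_varSet I e 2
          have hene : e ≠ k := fun h => hkJ (h ▸ heJ)
          have heX₂ : e ∈ X₂ := hCX₂ (mem_insert_self _ _)
          rcases hs23 with rfl | rfl
          · rcases hgv with ⟨h2, -⟩ | ⟨h2, -⟩
            · exact ⟨e, heX₂, hene, h2 ▸ hp_e⟩
            · exact ⟨j₀, hj₀X, hj₀ne, h2 ▸ hu_j₀⟩
          · rcases hgv with ⟨-, h3⟩ | ⟨-, h3⟩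
            · exact ⟨j₀, hj₀X, hj₀ne, h3 ▸ hu_j₀⟩
            · exact ⟨e, heX₂, hene, h3 ▸ hp_e⟩
        · have hj₁ne : j₁ ≠ k := fun h => hkJ (h ▸ hTJ hj₁T)
          have hj₂ne : j₂ ≠ k := fun h => hkJ (h ▸ hTJ hj₂T)
          have hslot : I.vars k s' = σ ∨ I.vars k s' = τ := by
            rcases (mem_andPair_iff I k σ).1 hσg with h1 | h1 <;> rcases (mem_andPair_iff I k τ).1 hτg with h2 | h2
            · exact absurd (h1.trans h2.symm) hστ
            · rcases hs23 with rfl | rfl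
              · exact Or.inl h1.symm
              · exact Or.inr h2.symm
            · rcases hs23 with rfl | rfl
              · exact Or.inr h2.symm
              · exact Or.inl h1.symm
            · exact absurd (h1.trans h2.symm) hστ
          rcases hslot with h | h
          · exact ⟨j₁, hHX₂ hj₁H, hj₁ne, h ▸ andPair_subset_varSet I j₁ hσ⟩
          · exact ⟨j₂, hHX₂ hj₂H, hj₂ne, h ▸ andPair_subset_varSet I j₂ hτ⟩
      have h := card_varSet_inter_bdry_le I X₂ k {2, 3} (fun s' hs' => by
        simp only [mem_insert, mem_singleton] at hs'
        have hs2 : 2 ≤ s'.val := by rcases hs' with rfl | rfl <;> decide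
        obtain ⟨k', hk'X, hne, hv⟩ := hAND s' hs2
        exact not_mem_bdry_of_two I hk hk'X (Ne.symm hne) (vars_mem_varSet I k s') hv)
      have h2 : ({2, 3} : Finset (Fin 4)).card = 2 := by decide
      rw [h2] at h
      exact h
  have hbd₂ := card_bdry_le_sum I X₂ q₂ hq₂
  have hX₂split : X₂ = C ∪ Gx := by
    rw [hX₂def, hGx]
    ext k
    simp only [mem_union, mem_sdiff, mem_insert, mem_singleton]
    constructor
    · rintro (h | h)
      · exact Or.inl h
      · by_cases hkJ : k ∈ B.J₀
        · rcases h with rfl | rfl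
          · exact absurd hkJ hg₀J
          · -- `g ∈ J₀`: a join edge, in the tree, in `C`
            left
            rcases mem_union.1 hg with hg' | hg' <;> rcases mem_union.1 hg' with hg' | hg'
            · exact hTC (hW.hT₁ hg')
            · exact absurd hkJ (fun hkJ => disjoint_left.1 hd₁ (mem_filter.1 hg').1 hkJ)
            · exact hTC (hW.hT₂ hg')
            · exact absurd hkJ (fun hkJ => disjoint_left.1 hd₂ (mem_filter.1 hg').1 hkJ)
        · exact Or.inr ⟨h, hkJ⟩
    · rintro (h | ⟨h, -⟩)
      · exact Or.inl h
      · exact Or.inr h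
  have hdisj₂ : Disjoint C Gx := disjoint_left.2 fun k hkC hkG => (mem_sdiff.1 hkG).2 (hCJ hkC)
  have hq₂_C : ∑ k ∈ C, q₂ k = C.card := by
    rw [card_eq_sum_ones]; exact sum_congr rfl fun k hk => by simp only [q₂, if_pos hk]
  have hq₂_G : ∑ k ∈ Gx, q₂ k = 2 * Gx.card := by
    rw [mul_comm, card_eq_sum_ones, sum_mul]
    refine sum_congr rfl fun k hk => ?_
    have hkC : k ∉ C := fun h => (mem_sdiff.1 hk).2 (hCJ h)
    simp only [q₂, if_neg hkC, one_mul]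
  have hsum₂ : ∑ k ∈ X₂, q₂ k = C.card + 2 * Gx.card := by rw [hX₂split, sum_union hdisj₂, hq₂_C, hq₂_G]
  have hcard₂ : X₂.card = C.card + Gx.card := by rw [hX₂split, card_union_of_disjoint hdisj₂]
  have hCcard : C.card = T.card + 1 := by rw [hCdef, card_insert_of_notMem heD, hTD]
  have h2D : 2 ≤ (B.D e).card := PstarChordBridgeFundamental.two_le_card_of_even I hI hS heD (hW.hDeven e he)
  have hexp₂ := hB X₂ hX₂r
  rw [hcard₂, hCcard] at hexp₂
  rw [hsum₂, hCcard] at hbd₂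
  rw [hTD] at hexp₂ hbd₂
  by_cases hgJ : g ∈ B.J₀
  · rw [if_pos hgJ] at hGcard
    rw [hGcard] at hexp₂ hbd₂
    omega
  · rw [if_neg hgJ] at hGcard
    rw [hGcard] at hexp₂ hbd₂
    omega


end Summit.PneNP.PneNP.Theorems.PstarGateCasePNorCountCycle
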